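import Mathlib
import HarnessLib
import Summits.AtomisticToContinuum.Crystallization.Theorems.PricedLinkCensusSoftFourRingsRigPlace

/-!
# Soft four-rings, metric half by certified numerics (3): linearised constraints and safe LP bounds

Route `PricedLinkCensus`, sub-problem `Crystallization`, item `SoftFourRings`
(stmt-AtomisticToContinuum-14234).  The checker keeps a box (an `IVec`) for every placed point
`x v ∈ ℝ³` of the twelve-point configuration and repeatedly SHRINKS the boxes by linear
programming bounds.  Writing `x = c + d` with `c` the box centres (scaled integers `C/S`), every
quadratic constraint of the configuration (unit norms, bond and non-bond inner product windows)
becomes a LINEAR inequality in `d` with an explicit remainder controlled by the box radii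
(`rowsOf`, soundness `rows_hold`).  A bound on a coordinate of `d` — or the infeasibility of the
whole system — is then certified by a non-negative combination of these rows supplied as data
(`certUpper`, `certInfeasible`): the Neumaier–Shcherbina "safe bound"
`K·S·(obj·d) = Σⱼ Yⱼ (aⱼ·d) + r·d ≤ Σⱼ Yⱼ ubⱼ + Σ max(r·LO, r·HI)`, valid for ANY non-negative
integers `Yⱼ` (the data only affects sharpness, never soundness: `certUpper_sound`,
`certInfeasible_sound`).  All arithmetic is exact integer arithmetic at scale `S = 2^60`.
-/

namespace Summit.AtomisticToContinuum.Crystallization.Theorems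

namespace Rig

open Literature.Analysis.ValidatedNumerics.NumericsMP
open scoped Matrix

/-! ### The windows at tolerance one percent, as exact scaled integers -/

/-- Upper inner-product level for all pairs: `1 − 1/(2·1.01²) = 5201/10201`, scale `S²`, rounded up. -/
def CHI2 : ℤ := Literature.Analysis.ValidatedNumerics.Numerics.cdiv (5201 * ((SC : ℤ) * SC)) 10201

/-- Lower inner-product level for bonds: `1 − 1.01²/2 = 9799/20000`, scale `S²`, rounded down. -/
def CBLO2 : ℤ := 9799 * ((SC : ℤ) * SC) / 20000

/-- Upper inner-product level for non-bonds: `1.01/2 = 101/200`, scale `S²`, rounded up. -/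
def CNB2 : ℤ := Literature.Analysis.ValidatedNumerics.Numerics.cdiv (101 * ((SC : ℤ) * SC)) 200

/-- The bond-cosine interval `[9799/20000, 5201/10201]` at scale `S` (outward). -/
def kappaI : MI := ⟨9799 * (SC : ℤ) / 20000,
  Literature.Analysis.ValidatedNumerics.Numerics.cdiv (5201 * (SC : ℤ)) 10201⟩

/-- The real levels. -/
noncomputable def chiR : ℝ := 5201 / 10201
/-- The real levels. -/
noncomputable def cbloR : ℝ := 9799 / 20000
/-- The real levels. -/
noncomputable def cnbR : ℝ := 101 / 200

/-- `S² · chiR ≤ CHI2`. -/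
theorem chi_le_CHI2 : (SC : ℝ) * SC * chiR ≤ (CHI2 : ℝ) := by
  have h := Literature.Analysis.ValidatedNumerics.Numerics.div_le_cdiv (a := 5201 * ((SC : ℤ) * SC))
    (b := 10201) (by norm_num)
  rw [CHI2, chiR]
  push_cast at h ⊢
  have : (SC : ℝ) * SC * (5201 / 10201) = 5201 * ((SC : ℝ) * SC) / 10201 := by ring
  rw [this]; exact h

/-- `CBLO2 ≤ S² · cbloR`. -/
theorem CBLO2_le_cblo : (CBLO2 : ℝ) ≤ (SC : ℝ) * SC * cbloR := by
  have h := Literature.Analysis.ValidatedNumerics.Numerics.fdiv_le_div (a := 9799 * ((SC : ℤ) * SC))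
    (b := 20000) (by norm_num)
  rw [CBLO2, cbloR]
  push_cast at h ⊢
  have : (SC : ℝ) * SC * (9799 / 20000) = 9799 * ((SC : ℝ) * SC) / 20000 := by ring
  rw [this]; exact h

/-- `S² · cnbR ≤ CNB2`. -/
theorem cnb_le_CNB2 : (SC : ℝ) * SC * cnbR ≤ (CNB2 : ℝ) := by
  have h := Literature.Analysis.ValidatedNumerics.Numerics.div_le_cdiv (a := 101 * ((SC : ℤ) * SC))
    (b := 200) (by norm_num)
  rw [CNB2, cnbR]
  push_cast at h ⊢
  have : (SC : ℝ) * SC * (101 / 200) = 101 * ((SC : ℝ) * SC) / 200 := by ring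
  rw [this]; exact h

/-- Bond cosines lie in `kappaI`. -/
theorem mem_kappaI {x : ℝ} (h1 : cbloR ≤ x) (h2 : x ≤ chiR) : MI.mem SC x kappaI := by
  have hS : (0 : ℝ) < SC := by exact_mod_cast SC_pos
  constructor
  · have h := Literature.Analysis.ValidatedNumerics.Numerics.fdiv_le_div (a := 9799 * (SC : ℤ))
      (b := 20000) (by norm_num)
    simp only [kappaI]
    push_cast at h ⊢
    rw [cbloR] at h1
    have : (9799 : ℝ) * SC / 20000 ≤ x * SC := by nlinarith
    exact h.trans this
  · have h := Literature.Analysis.ValidatedNumerics.Numerics.div_le_cdiv (a := 5201 * (SC : ℤ))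
      (b := 10201) (by norm_num)
    simp only [kappaI]
    push_cast at h ⊢
    rw [chiR] at h2
    have : x * SC ≤ (5201 : ℝ) * SC / 10201 := by nlinarith
    exact this.trans h

/-! ### Boxes, centres, radii -/

/-- The checker's knowledge: a box for every placed point. -/
abbrev Boxes : Type := Fin 12 → Option IVec

/-- The interval of coordinate `k` of point `v` (junk `zeroI` if unplaced). -/
def Boxes.ivl (bx : Boxes) (v : Fin 12) (k : Fin 3) : MI :=
  match bx v with
  | some B => B.get k
  | none => zeroI

/-- Is point `v` placed? -/
def Boxes.placed (bx : Boxes) (v : Fin 12) : Bool := (bx v).isSome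

/-- Scaled centre `C = ⌊(lo + hi)/2⌋`. -/
def Boxes.C (bx : Boxes) (v : Fin 12) (k : Fin 3) : ℤ := ((bx.ivl v k).lo + (bx.ivl v k).hi) / 2
/-- Scaled lower displacement bound `lo − C`. -/
def Boxes.LO (bx : Boxes) (v : Fin 12) (k : Fin 3) : ℤ := (bx.ivl v k).lo - bx.C v k
/-- Scaled upper displacement bound `hi − C`. -/
def Boxes.HI (bx : Boxes) (v : Fin 12) (k : Fin 3) : ℤ := (bx.ivl v k).hi - bx.C v k
/-- Scaled radius `max |LO| |HI|`. -/
def Boxes.R (bx : Boxes) (v : Fin 12) (k : Fin 3) : ℤ := max |bx.LO v k| |bx.HI v k|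

/-- Membership of a configuration in the boxes: every PLACED point lies in its box. -/
def Boxes.mem (bx : Boxes) (x : Fin 12 → Fin 3 → ℝ) : Prop :=
  ∀ v B, bx v = some B → B.mem (x v)

/-- The real centre `c = C/S`. -/
noncomputable def Boxes.c (bx : Boxes) (v : Fin 12) (k : Fin 3) : ℝ := (bx.C v k : ℝ) / SC

/-! ### Rows -/

/-- A linear row `Σ a·d ≤ ub/S` (coefficients at scale `S`, bound at scale `S²`). -/
structure Row where
  /-- coefficients -/
  a : Fin 12 → Fin 3 → ℤ
  /-- scaled bound -/
  ub : ℤ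

/-- The real meaning of a row for a displacement field `d`. -/
def Row.Holds (r : Row) (d : Fin 12 → Fin 3 → ℝ) : Prop :=
  (∑ v, ∑ k, (r.a v k : ℝ) * d v k) ≤ (r.ub : ℝ) / SC

/-- Coefficients of the pair row `(i, j)`: `c_j` on the coordinates of `i`, `c_i` on those of `j`. -/
def pairCoeff (bx : Boxes) (i j : Fin 12) : Fin 12 → Fin 3 → ℤ :=
  fun v k => (if v = i then bx.C j k else 0) + (if v = j then bx.C i k else 0)

/-- `Σ_k C_ik C_jk` (scale `S²`). -/
def c0 (bx : Boxes) (i j : Fin 12) : ℤ := ∑ k, bx.C i k * bx.C j k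
/-- `Σ_k R_ik R_jk` (scale `S²`). -/
def rem (bx : Boxes) (i j : Fin 12) : ℤ := ∑ k, bx.R i k * bx.R j k

/-- The rows of the pair `(i, j)`: two for a bond (window), one for a non-bond (upper level). -/
def pairRows (bond : Fin 12 → Fin 12 → Bool) (bx : Boxes) (i j : Fin 12) : List Row :=
  if bond i j then
    [⟨pairCoeff bx i j, CHI2 - c0 bx i j + rem bx i j⟩,
     ⟨fun v k => -pairCoeff bx i j v k, -CBLO2 + c0 bx i j + rem bx i j⟩]
  else [⟨pairCoeff bx i j, CNB2 - c0 bx i j + rem bx i j⟩]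

/-- The two sphere rows of point `i`. -/
def sphereRows (bx : Boxes) (i : Fin 12) : List Row :=
  [⟨fun v k => if v = i then 2 * bx.C i k else 0, (SC : ℤ) * SC - c0 bx i i⟩,
   ⟨fun v k => if v = i then -(2 * bx.C i k) else 0, -((SC : ℤ) * SC - c0 bx i i) + rem bx i i⟩]

/-- All ordered pairs `i < j`. -/
def allPairs : List (Fin 12 × Fin 12) :=
  (List.finRange 12).flatMap fun i => (List.finRange 12).filterMap fun j =>
    if i < j then some (i, j) else none

/-- **The canonical row list** of the current boxes (pairs of placed points in lexicographic
order, then the sphere rows of placed points). -/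
def rowsOf (bond : Fin 12 → Fin 12 → Bool) (bx : Boxes) : List Row :=
  (allPairs.flatMap fun p => if bx.placed p.1 && bx.placed p.2 then pairRows bond bx p.1 p.2 else [])
    ++ ((List.finRange 12).flatMap fun i => if bx.placed i then sphereRows bx i else [])

/-! ### Certificates -/

/-- A bound certificate: a positive scale `K` and sparse non-negative integer multipliers
`(j, Yⱼ)` indexing the canonical row array. -/
abbrev Cert : Type := ℕ × List (ℕ × ℕ)

/-- `Σ_t Y_t · a_{j_t}` (coefficient field of the dual combination; unknown row indices skipped). -/
def termCoeff (rows : Array Row) : List (ℕ × ℕ) → Fin 12 → Fin 3 → ℤ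
  | [], _, _ => 0
  | t :: ts, v, k => (match rows[t.1]? with
      | some r => (t.2 : ℤ) * r.a v k
      | none => 0) + termCoeff rows ts v k

/-- `Σ_t Y_t · ub_{j_t}`. -/
def dualBound (rows : Array Row) : List (ℕ × ℕ) → ℤ
  | [] => 0
  | t :: ts => (match rows[t.1]? with
      | some r => (t.2 : ℤ) * r.ub
      | none => 0) + dualBound rows ts

/-- The residual `r = K·S·obj − Σ Yⱼ aⱼ`. -/
def residual (rows : Array Row) (K : ℕ) (obj : Fin 12 → Fin 3 → ℤ) (terms : List (ℕ × ℕ))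
    (v : Fin 12) (k : Fin 3) : ℤ :=
  (K : ℤ) * SC * obj v k - termCoeff rows terms v k

/-- `Σ_{v,k} max (r·LO) (r·HI)`. -/
def boxSlack (bx : Boxes) (r : Fin 12 → Fin 3 → ℤ) : ℤ :=
  ∑ v, ∑ k, max (r v k * bx.LO v k) (r v k * bx.HI v k)

/-- **Safe upper bound** `U` with `obj·d ≤ U/S`, from any certificate (Neumaier–Shcherbina). -/
def certUpper (bx : Boxes) (rows : Array Row) (obj : Fin 12 → Fin 3 → ℤ) (cert : Cert) : ℤ :=
  Literature.Analysis.ValidatedNumerics.Numerics.cdiv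
    (dualBound rows cert.2 + boxSlack bx (residual rows (max cert.1 1) obj cert.2))
    ((max cert.1 1 : ℕ) * (SC : ℤ))

/-- **Farkas test**: the combination certifies that no displacement satisfies rows and box. -/
def certInfeasible (bx : Boxes) (rows : Array Row) (terms : List (ℕ × ℕ)) : Bool :=
  decide (dualBound rows terms + boxSlack bx (residual rows 1 (fun _ _ => 0) terms) < 0)

end Rig

end Summit.AtomisticToContinuum.Crystallization.Theorems
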